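import Summits.QuantumFields.BalabanUV.Beta.SymRootedAveragingReflection
import Summits.QuantumFields.BalabanUV.Beta.RootedMixedChartReflection

/-!
# `BalabanUV.Beta.SymRootedMixedChartReflection` — the TRANSVERSE (`μ ≠ α`) and LONGITUDINAL (`μ = α`) reflection laws of the
# (0.4)-SYMMETRISED rooted mixed averaging `symPhiMAt` on node 12b's MIXED chart `U_f = Z_f·(1 + σB_f)` (β sub-cell, row D1,
# TABLES-SYM-LEAN S2c, INTERFACE-LEVEL twin of leaf-05's `RootedMixedChartReflection`; an1 gen 43, option (C) of S2C-SCOPE-v1)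

HONEST FRAMING (cell charter, verbatim): «discharging BetaPertH makes Bałaban's UV stability UNCONDITIONAL — a real
constructive-QFT result; it is NOT the continuum limit and NOT the Clay problem.»  HONEST DEPENDENCY (verbatim): «continuum YM on
T⁴ ⇐ BetaPertH ∧ nine spine estimates (0/9 proved); BetaPertH ⇐ (D1) ∧ (D4) ∧ CAP+tail; G-an2-4 gates asym, D1 and NE2/3/4.»
ABSOLUTE RULE (R-g25-7 ∕ R-D1-g30-1 (A)): the (0.4)-symmetrised averaging is the exp of the MEAN OF LOGS over the pair family; every
object below is node 12b's mixed-chart algebra read on an1's `symPhiGAt` (S2b part 1) instead of the comb `PhiGAt`.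
DERIVED cell leaf: [folklore] ring algebra.  The chart letters `GmL`∕`GmbL`, the bridges `Gm_eq_GmL`∕`Gmb_eq_GmbL`, the reflected
background letter `BR`, the inverse pair `Zf_mul_Zb`∕`Gm_mul_Gmb`∕`augR_Gm` and the reflected chart data `reflPair_Gm_Gmb`∕`reflPair_Gmb_Gm`
are FAMILY-INDEPENDENT and imported BY NAME from `RootedMixedChartReflection`; the averaging-specific inputs are an1's
`symPhiGAt_sref_of_ne`, `symPhiGAt_reflPair_self_eq_invT`, `symPhiGAt_reflPair_self_mul` (`SymRootedAveragingReflection`).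
No statement of Bałaban's papers is typed here, no `[cite:]` tag, no `Prop` is minted, no binder of the β-function wall
(`hW`/`hR`/`D1Tel`/`D1Rep`, (D1), `BetaPertH`) is instantiated or discharged; nothing about `symMixFFAt`∕`symVh₂SAt`∕(T2-B)∕(T2-M₂).
NOT summit progress.

## What this module proves (sym twin of `RootedMixedChartReflection` §1 (rooted families + bridges), §2, §3 — `PhiXAt ↦ symPhiXAt`)
* §1 `symPhiMLAt`, `symMσLAt`, `symMjetLAt := c11 ∘ symMσLAt`; bridges `symPhiMAt_eq_symPhiMLAt`, `symMjetLAt_eq_c11` (`rfl`),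
  `symMjetAt_eq_symMjetLAt`.
* §2 `symPhiMAt_sref_of_ne` (`μ ≠ α`): `symPhiMAt (ctr d L) W V B L μ (sref α y) = symPhiMLAt (ctr d L) Z♯ Z̄♯ B♯ L μ y`.
* §3 `symPhiMLAt_reflPair_self_eq_invT` (`μ = α`): `symPhiMLAt (ctr d L) Z♯ Z̄♯ B♯ L α y = invT (symPhiMAt (ctr d L) W V B L α (bref α α y))`
  and its product form `symPhiMLAt_reflPair_self_mul`.
-/

namespace Summit.QuantumFields.BalabanUV.Beta.SymRootedMixedChartReflection

open Finset
open scoped BigOperators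
open Literature.MathematicalPhysics.QuantumFieldTheory.Balaban1983to89
open Literature.MathematicalPhysics.QuantumFieldTheory.Balaban1983to89.Beta
open AffineAveraging (Form1)
open AveragingContoursRooted (ctr)
open Literature.MathematicalPhysics.QuantumFieldTheory.Balaban1983to89.Beta.AveragingThirdJet
open Literature.MathematicalPhysics.QuantumFieldTheory.Balaban1983to89.Beta.AveragingThirdJet.Tau
open AveragingMixedJetTables (Zf Zb Gm Gmb)
open ResolventReflection (sref bref bref_of_ne bref_self)
open Summit.QuantumFields.BalabanUV.Beta.SymAveragingMixedJetTables (symPhiGAt map_symPhiGAt symPhiMAt symMjetAt)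
open Summit.QuantumFields.BalabanUV.Beta.SymRootedAveragingReflection (symPhiGAt_sref_of_ne symPhiGAt_reflPair_self_eq_invT
  symPhiGAt_reflPair_self_mul)
open Summit.QuantumFields.BalabanUV.Beta.RootedHolonomyReflection (R1g R1g_of_ne)
open Summit.QuantumFields.BalabanUV.Beta.RootedHolonomyReflectionHol (reflPair reflPair_of_ne reflPair_self)
open Summit.QuantumFields.BalabanUV.Beta.TruncatedNil4Calculus (nil4_augR)
open Summit.QuantumFields.BalabanUV.Beta.RootedMixedChartReflection (GmL GmbL fst_GmL snd_GmL fst_GmbL snd_GmbL Gm_eq_GmL Gmb_eq_GmbL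
  BR BR_of_ne BR_self Zf_mul_Zb Zb_mul_Zf reflPair_Gm_Gmb reflPair_Gmb_Gm Gm_mul_Gmb Gmb_mul_Gm augR_Gm augR_Gmb)

variable (𝕜 : Type*) [Field 𝕜] {d : ℕ} {𝔸 : Type*} [Ring 𝔸] [Algebra 𝕜 𝔸]

/-! ## §1 The symmetrised rooted families on the mixed left chart and the bridges -/

section MixedCharts

/-- [our object] The (0.4)-symmetrised rooted averaging on the mixed left chart (sym twin of `PhiMLAt`). -/
noncomputable def symPhiMLAt (ρ : Fin d → ℤ) (Z Zb' b : Form1 d (Tau 𝔸)) (L : ℕ) (μ : Fin d) (y : Fin d → ℤ) : Rho 𝔸 :=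
  symPhiGAt 𝕜 ρ (GmL Z b) (GmbL Zb' b) L μ y

/-- [our object] The `Tau`-valued `σ`-JET of the symmetrised averaging on the mixed left chart, right-trivialised by the reference
averaging `(Z, Z̄) := (Z₀, Z̄₀)` (sym twin of `MσLAt`). -/
noncomputable def symMσLAt (ρ : Fin d → ℤ) (Z Zb' Z₀ Zb₀ b : Form1 d (Tau 𝔸)) (L : ℕ) (μ : Fin d) (y : Fin d → ℤ) : Tau 𝔸 :=
  (logT 𝕜 (symPhiMLAt 𝕜 ρ Z Zb' b L μ y * invT (symPhiMLAt 𝕜 ρ Z₀ Zb₀ b L μ y))).snd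

/-- [our object] The symmetrised rooted MIXED JET on the mixed left chart: `symMjetLAt = c11 (symMσLAt …)` (sym twin of `MjetLAt`). -/
noncomputable def symMjetLAt (ρ : Fin d → ℤ) (Z Zb' Z₀ Zb₀ b : Form1 d (Tau 𝔸)) (L : ℕ) (μ : Fin d) (y : Fin d → ℤ) : 𝔸 :=
  c11 (symMσLAt 𝕜 ρ Z Zb' Z₀ Zb₀ b L μ y)

variable {𝕜}

/-- [folklore] BRIDGE `symPhiMAt = symPhiMLAt` at `(Zf W V, Zb W V, upF B)`. -/
theorem symPhiMAt_eq_symPhiMLAt (ρ : Fin d → ℤ) (W V B : Form1 d 𝔸) (L : ℕ) (μ : Fin d) (y : Fin d → ℤ) :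
    symPhiMAt 𝕜 ρ W V B L μ y = symPhiMLAt 𝕜 ρ (Zf 𝕜 W V) (Zb 𝕜 W V) (upF B) L μ y := by
  rw [symPhiMAt, symPhiMLAt, Gm_eq_GmL, Gmb_eq_GmbL]

/-- [folklore] `symMjetLAt = c11 ∘ symMσLAt` (by `rfl`). -/
theorem symMjetLAt_eq_c11 (ρ : Fin d → ℤ) (Z Zb' Z₀ Zb₀ b : Form1 d (Tau 𝔸)) (L : ℕ) (μ : Fin d) (y : Fin d → ℤ) :
    symMjetLAt 𝕜 ρ Z Zb' Z₀ Zb₀ b L μ y = c11 (symMσLAt 𝕜 ρ Z Zb' Z₀ Zb₀ b L μ y) := rfl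

/-- [folklore] BRIDGE `symMjetAt = symMjetLAt` at `(Zf W V, Zb W V; Zf 0 0, Zb 0 0; upF B)`. -/
theorem symMjetAt_eq_symMjetLAt (ρ : Fin d → ℤ) (W V B : Form1 d 𝔸) (L : ℕ) (μ : Fin d) (y : Fin d → ℤ) :
    symMjetAt 𝕜 ρ W V B L μ y = symMjetLAt 𝕜 ρ (Zf 𝕜 W V) (Zb 𝕜 W V) (Zf 𝕜 0 0) (Zb 𝕜 0 0) (upF B) L μ y := by
  rw [symMjetAt, symMjetLAt, symMσLAt, symPhiMAt_eq_symPhiMLAt, symPhiMAt_eq_symPhiMLAt]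

end MixedCharts

/-! ## §2 The transverse law of the symmetrised mixed averaging (`μ ≠ α`) -/

section MixedTransverse

variable {𝕜} {L : ℕ} (hL : Odd L)
include hL

/-- [folklore] **`μ ≠ α`, MIXED CHART, SYMMETRISED AVERAGING: THE ROOTED AVERAGING AT THE REFLECTED COARSE BOND IS THE MIXED LEFT-CHART
AVERAGING OF THE REFLECTED DATA** (characteristic `≠ 2`; an1's `symPhiGAt_sref_of_ne` read through `reflPair_Gm_Gmb`∕`reflPair_Gmb_Gm`). -/
theorem symPhiMAt_sref_of_ne (h2 : (2 : 𝕜) ≠ 0) {α μ : Fin d} (h : μ ≠ α) (W V B : Form1 d 𝔸) (y : Fin d → ℤ) :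
    symPhiMAt 𝕜 (ctr d L) W V B L μ (sref α y)
      = symPhiMLAt 𝕜 (ctr d L) (reflPair α (Zf 𝕜 W V) (Zb 𝕜 W V)) (reflPair α (Zb 𝕜 W V) (Zf 𝕜 W V))
          (BR (𝕜 := 𝕜) α W V B) L μ y := by
  rw [symPhiMAt, symPhiGAt_sref_of_ne 𝕜 hL h, reflPair_Gm_Gmb h2, reflPair_Gmb_Gm h2, symPhiMLAt]

end MixedTransverse

/-! ## §3 The longitudinal law of the symmetrised mixed averaging (`μ = α`): the reflected averaging is the INVERSE -/

section MixedAxis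

variable {𝕜}

/-- [folklore] **`μ = α`, MIXED CHART, SYMMETRISED AVERAGING: THE MIXED LEFT-CHART AVERAGING OF THE REFLECTED DATA AT `(α, y)` IS THE
INVERSE OF THE ROOTED MIXED AVERAGING AT THE PARTNER BOND `(α, bref α α y)`** (an1's `symPhiGAt_reflPair_self_eq_invT` at node 12's instance
`Rho 𝔸`, `augR`, `nil4_augR`; `L` odd, characteristic `≠ 2`). -/
theorem symPhiMLAt_reflPair_self_eq_invT {L : ℕ} (hL : Odd L) (h2 : (2 : 𝕜) ≠ 0) (α : Fin d) (W V B : Form1 d 𝔸) (y : Fin d → ℤ) :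
    symPhiMLAt 𝕜 (ctr d L) (reflPair α (Zf 𝕜 W V) (Zb 𝕜 W V)) (reflPair α (Zb 𝕜 W V) (Zf 𝕜 W V)) (BR (𝕜 := 𝕜) α W V B) L α y
      = invT (symPhiMAt 𝕜 (ctr d L) W V B L α (bref α α y)) := by
  rw [symPhiMLAt, ← reflPair_Gm_Gmb h2, ← reflPair_Gmb_Gm h2, symPhiMAt]
  exact symPhiGAt_reflPair_self_eq_invT hL (nil4_augR (𝕜 := 𝕜)) h2 (augR_Gm W V B) (augR_Gmb W V B)
    (Gm_mul_Gmb h2 W V B) (Gmb_mul_Gm h2 W V B) α y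

/-- [folklore] `μ = α`, MIXED CHART, SYMMETRISED AVERAGING, product form:
`symΦ^L_{(α,y)}(Z♯, Z̄♯, B♯) · symΦ^M_{(α, bref α α y)}(W, V, B) = 1`. -/
theorem symPhiMLAt_reflPair_self_mul {L : ℕ} (hL : Odd L) (h2 : (2 : 𝕜) ≠ 0) (α : Fin d) (W V B : Form1 d 𝔸) (y : Fin d → ℤ) :
    symPhiMLAt 𝕜 (ctr d L) (reflPair α (Zf 𝕜 W V) (Zb 𝕜 W V)) (reflPair α (Zb 𝕜 W V) (Zf 𝕜 W V)) (BR (𝕜 := 𝕜) α W V B) L α y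
        * symPhiMAt 𝕜 (ctr d L) W V B L α (bref α α y) = 1 := by
  rw [symPhiMLAt, ← reflPair_Gm_Gmb h2, ← reflPair_Gmb_Gm h2, symPhiMAt]
  exact symPhiGAt_reflPair_self_mul hL (nil4_augR (𝕜 := 𝕜)) h2 (augR_Gm W V B) (augR_Gmb W V B)
    (Gm_mul_Gmb h2 W V B) (Gmb_mul_Gm h2 W V B) α y

end MixedAxis

end Summit.QuantumFields.BalabanUV.Beta.SymRootedMixedChartReflection
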